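import Summits.Parity.BatemanHorn.Theses.SelbergDelangeRigidity
import Summits.Parity.BatemanHorn.Theorems.LSDRealSegment.Negative.Structure
import Summits.Parity.BatemanHorn.Theorems.LSDRealSegment.Negative.NoSpikes
import Literature.NumberTheory.Sieve.BatemanHornProofs

/-!
# Line `shared-kernel-uncapped-transfer` — checked skeleton for crux `LSDRealSegment`
(item stmt-Parity-9770, route `SelbergDelangeRigidity`, sub-problem `BatemanHorn`)

Crux (by name, concluded by `LSDRealSegment_of` below, fed by `lsdRealSegment_of_parts`):
`Summit.Parity.BatemanHorn.Theses.SelbergDelangeRigidity.LSDRealSegment` — for every Bateman–Horn system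
`f = (f₁,…,f_k)` there is `Λ` holomorphic on `|z| < 2` with `Λ 0 = C(f) = batemanHornConst f` such that for
every real `y ∈ (5/4, 7/4)`, `x⁻¹ (log x)^{k(1−y)} Σ_{n ≤ x} y^{Ω_f(n)} → Λ(y) D^{y−1} Γ(y)^{−k}`,
`Ω_f(n) = Σᵢ Ω(fᵢ(n))` (`ArithmeticFunction.cardFactors` of `toNat` values: the UN-capped statistic),
`D = ∏ deg fᵢ`.

## The line (idea card `Ideas/shared-kernel-uncapped-transfer.md`; triage `TRIAGE-r1-{1,2,3}.md`: pass ×3)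

ONE KERNEL, TWO CRUXES.  The sibling crux `AlmostPrimeZeros.SystemLSDRealSegment` (stmt-Parity-11292) is the
same law for the CAPPED statistic `s_f = ΣᵢΣ_p min(v_p(fᵢ(n)), 2)`; its checked line `ewens-pd-kernel` reduces
it to ONE open, `y`-FREE, CAP-FREE statement `KPD` (law of the windowed large-prime count of the `fᵢ(n)` inside
smooth divisor classes = law of the same count for independent uniform integers) plus Euler / Ewens bookkeeping.
This line files the UN-capped crux on the SAME kernel: `KPD` and `IntegerEwens` below are copied VERBATIM from
`Cruxes/SystemLSDRealSegment/Lines/ewens-pd-kernel.lean` (same text, same auxiliary definitions `windowCount`,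
`smoothPart`, `admissible`, `divClass`, `sysWindowCount`, `modelMean`, `modelLaw`; only the namespace differs,
so a proof of either registered `stub_kpd` transports to the other by `Iff.rfl`), and everything the cap bought
the sibling is re-bought for `Ω` by FOUR new Ω-specific inputs, each using `y < 2` at a named place:

* `stub_localEulerOmega` (M+M, provable now): the un-capped local factor is the POWER SERIES
  `E_p^Ω(z) = Σ_ν P(p^ν ∥ F(n)) z^ν` (`F = ∏ fᵢ`; radius `≥ p` because root counts of the squarefree `F`
  modulo `p^ν` are bounded in `ν` — Hensel off `disc·res`, Huxley 1981 / Stewart 1991 at the bad primes: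
  `densOmega f p ν ≤ C_f p^{−ν}`), so `λ_f^Ω = eulerFactorOmega f = ∏_p E_p^Ω(z)(1−1/p)^{k(z−1)}` is holomorphic
  on `|z| < 2` ONLY (not entire: `E_2^Ω = (1−½)/(1−z/2)` at `f = X`, pole at `2` — `Negative.SharpRadius`),
  `λ(0) = C(f)`, `λ(1) = 1`, `λ(t) > 0` on `(0,2)` [y<2 place 1: the radius of `E_2^Ω`]; and the small-prime
  expansion with UNBOUNDED prime powers (`y^{Ω(m)} = Σ_{d∣m} g_y(d)`, `g_y(p^ν) = y^{ν−1}(y−1)` for EVERY `ν`,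
  PROVED below as `pow_cardFactors_eq_sum_divisors`) still has complete periods modulo `lcm(dᵢ) ≤ x^η` and a
  Rankin tail now containing `Σ_{2^ν > x^η}(y/2)^ν` [y<2 place 2].
* `stub_spikeControl` (a THEOREM in print, to vendor: Bugeaud–Evertse–Győry 2018 Thm 2.1(i) = p-adic
  Thue–Siegel–Roth, Ridout 1958): `∏_{p ≤ P} p^{v_p(F(n))} ≤ n^{1+ε}` eventually.  Triage r1-1 finding F0: the
  crux itself implies `[fᵢ(n)]₂ ≤ n^{1.2386+o(1)}` (`Negative.NoSpikes`), so every un-capped line must import a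
  Roth-type input; here it enters exactly once, as the hypothesis of `stub_peeledTails`.  `F` is squarefree
  precisely because the `fᵢ` are irreducible and pairwise non-associated (`Negative.LoadBearing`: for `X²` and
  `(X, X)` the statement is FALSE, `[n²]₂ = n²` at `n = 2^a`).
* `stub_peeledTails` (L; Nair–Tenenbaum 1998 Thm 1 / Henriot 2012 Thm 3 on the small-prime-PEELED weight — not in
  the tree — plus `SpikeControl` for the un-peelable part): LONG-SUM order bound, smooth tail and top class for the
  un-capped tilt, `1 ≤ t < 2` [y<2 places 3 and 4: the peeling `Σ_ν (t/p)^ν` at `p = 2`, and `(1+ε)log₂ t < 1` in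
  the spike step].  The card's short-interval stub `UncappedShortIntervalBound` was REFUTED as typed
  (`TriageR1K1UncappedShortIntervalFalse`, `TriageR1K2StubsFalse`: one power of `2` in a window of length `√x`
  carries it); clause (o) below is its repair — long sums `h = x` only, which is all the splice consumes.
* `stub_cubeFreeTail` (provable now for members of degree `≤ 3`; Hooley-1967-grade for degree `4`; OPEN for degree
  `≥ 5`): the tilted mass of `{n : p³ ∣ fᵢ(n) for some p > x^θ}` is negligible.  This is EXACTLY the content by
  which stmt-9770 exceeds stmt-11292 (triage r1-3 N2): `KPD` counts window primes with the cap `min(v,2)`, `Ω`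
  does not, and the two agree off this set.  Kept as its own stub so that no power-free-values problem hides in a
  stub labelled provable, and so that `KPD` stays literally the sibling's.
The remaining stubs are the sibling's, verbatim or mutatis mutandis: `stub_integerEwens` (calibration on ℕ,
VERBATIM), `stub_kpd` (THE KERNEL, VERBATIM, open, hardest), `stub_spliceOmega` (Ewens bookkeeping, M).

Monitor, not a stub (triage r1-2 (ii)): the `λ`-free Ewens ratio `S_x(y)/T_I(x,y) → D^{y−1}Γ(k(y−1)+1)/Γ(y)^k`
(card; kit j011626/j011697) is the crux minus the sibling line's Type-I theorem; it is not filed here.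

Scope / honesty.  `KPD`'s `j = 0` marginal in the class `d = 1` is "no prime factor of any `fᵢ(n)` in
`(x^θ, x^{dᵢ−κ}]`", i.e. Bateman–Horn for the cofactor families averaged over `x^{O(κ)}`-smooth twists (triage
r1-1 (B), r1-3 (ii)); for `Σ deg fᵢ ≥ 3` or `k ≥ 2` its moments are super-critical (BH-on-average hard; Disproof
§8(b)), for `Σ deg ≤ 2` sub-critical (DFI/Tóth scale).  The line adds NO mechanism for the kernel; it is a
transfer (card: "Transfer"), and the sibling lead PICKED `beta-thinned-root-kernel` whose open stub
`BetaKernelLaw` is the same object in `y`-dependent form (`KPD` + the provable stubs ⇒ `BetaKernelLaw^{cap}`).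

Disproof used (`Cruxes/LSDRealSegment/Disproof.lean` cycles 1–2 and the landed `Theorems/LSDRealSegment/Negative/*`,
two of them IMPORTED here): `false_without_irreducible` / `false_without_pairwise_not_associated` (LoadBearing)
are honoured at `stub_spikeControl` (squarefree `F`), at `stub_localEulerOmega` (`Σ_p(ω_f(p) − k)/p` converges;
for `(X,X)` it diverges) and at `stub_kpd` (independent model integers); `false_without_leadingCoeff_pos` at
`divClass` / the splice (expansion used for POSITIVE values only); `conclusion_fin_zero` (`k = 0`: `λ ≡ 1`,
every stub degenerates consistently); `WallAtTwo` / `WallAtTwoSharp` / `SharpRadius`: every `t`-range below is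
`t < 2` and `λ^Ω` is claimed on `ball 0 2` only (four named uses of `y < 2`); `NoSpikes` (imported): the line
meets it with `SpikeControl` (`spikeControl_noSpikes_shape` below restates the obligation);
`Structure.omegaLaw_Λ_unique` (imported): the line PRODUCES `Λ = λ_f^Ω`, and `eulerFactorOmega_unique_of_parts`
below checks that any witness coincides with it; `LinearRung.conclusion_X`: `E_p^Ω = (1−1/p)/(1−z/p)` at `f = X`
gives `λ_X^Ω = selbergDelangeOmegaF` (calibration of every constant).  No stub is an instance of a landed Negative
lemma (they refute hypothesis-dropped, `y ≥ 2`, radius `> 2` and short-interval variants only).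

`lean check`: rc 0, `sorry` exactly in the seven `stub_*`; `lsdRealSegment_of_parts` (hypothesis form, crux body
verbatim) and the expansion identities are real proofs; `LSDRealSegment_of : LSDRealSegment` is the by-name
skeleton theorem.
-/

namespace Summit.Parity.BatemanHorn.Cruxes.LSDRealSegment.SharedKernelUncappedTransfer

open Polynomial Filter Finset
open Literature.NumberTheory.Sieve
open Summit.Parity.BatemanHorn.Theses.SelbergDelangeRigidity (LSDRealSegment)
open ArithmeticFunction (cardFactors)
open scoped BigOperators Topology Classical

noncomputable section

/-! ### Objects of the line, I — VERBATIM from `Cruxes/SystemLSDRealSegment/Lines/ewens-pd-kernel.lean`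
(the shared kernel's vocabulary; keep textually identical) -/

/-- Windowed capped count: `Σ_{z < p ≤ w, p^v ∥ m} min(v, 2)` — the number of prime factors of `m` in the
window `(z, w]`, a prime whose square divides counted twice (the cap). [VERBATIM sibling] -/
def windowCount (z w : ℝ) (m : ℕ) : ℕ :=
  m.factorization.sum fun p v => if z < (p : ℝ) ∧ (p : ℝ) ≤ w then min v 2 else 0

/-- The `z`-smooth part of `m`: `∏_{p ≤ z} p^{v_p(m)}` (`= 1` for `m = 0`). [VERBATIM sibling] -/
def smoothPart (z : ℝ) (m : ℕ) : ℕ :=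
  m.factorization.prod fun p v => if (p : ℝ) ≤ z then p ^ v else 1

/-- The `i`-th value as a natural number (the crux's `toNat` convention). [VERBATIM sibling] -/
def val {k : ℕ} (f : Fin k → ℤ[X]) (i : Fin k) (n : ℕ) : ℕ :=
  ((f i).eval (n : ℤ)).toNat

/-- Admissible divisor tuples at `(θ, η, x)`: `d : Fin k → ℕ` with `1 ≤ dᵢ`, `∏ dᵢ ≤ x^η` and every prime factor
of every `dᵢ` at most `x^θ`.  (No cap on prime-power exponents — the un-capped expansion needs none.)
[VERBATIM sibling] -/
def admissible (k : ℕ) (θ η : ℝ) (x : ℕ) : Finset (Fin k → ℕ) :=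
  (Fintype.piFinset fun _ : Fin k => Icc 1 x).filter fun d =>
    (∏ i, (d i : ℝ)) ≤ (x : ℝ) ^ η ∧ ∀ i, ∀ p ∈ (d i).primeFactors, (p : ℝ) ≤ (x : ℝ) ^ θ

/-- The divisor class `A_d(x) = {0 ≤ n ≤ x : fᵢ(n) > 0 and dᵢ ∣ fᵢ(n) for every i}`. [VERBATIM sibling] -/
def divClass {k : ℕ} (f : Fin k → ℤ[X]) (d : Fin k → ℕ) (x : ℕ) : Finset ℕ :=
  (range (x + 1)).filter fun n : ℕ => ∀ i, 0 < (f i).eval (n : ℤ) ∧ ((d i : ℕ) : ℤ) ∣ (f i).eval (n : ℤ)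

/-- The windowed large-prime count of the system: `N_w(n) = Σᵢ #{x^θ < p ≤ x^{deg fᵢ − κ} : p ∣ fᵢ(n)}` (capped
multiplicity). [VERBATIM sibling] -/
def sysWindowCount {k : ℕ} (f : Fin k → ℤ[X]) (θ κ : ℝ) (x n : ℕ) : ℕ :=
  ∑ i, windowCount ((x : ℝ) ^ θ) ((x : ℝ) ^ (((f i).natDegree : ℝ) - κ)) (val f i n)

/-- INTEGER MODEL, tilted form: `X⁻¹ Σ_{1 ≤ m ≤ X} t^{windowCount z w m}`. [VERBATIM sibling] -/
def modelMean (X : ℕ) (z w t : ℝ) : ℝ :=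
  (X : ℝ)⁻¹ * ∑ m ∈ Icc 1 X, t ^ windowCount z w m

/-- INTEGER MODEL, law form: the probability that `k` INDEPENDENT uniform integers `mᵢ ≤ Xᵢ` have total windowed
count `Σᵢ windowCount z wᵢ mᵢ = j`. [VERBATIM sibling] -/
def modelLaw {k : ℕ} (X : Fin k → ℕ) (z : ℝ) (w : Fin k → ℝ) (j : ℕ) : ℝ :=
  (∏ i, (X i : ℝ))⁻¹ *
    (#((Fintype.piFinset fun i => Icc 1 (X i)).filter fun m => ∑ i, windowCount z (w i) (m i) = j) : ℝ)

/-- `IntegerEwens` — calibration on ℕ (Billingsley / Ewens sampling constant). [VERBATIM sibling] -/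
def IntegerEwens : Prop :=
  ∃ C : ℝ → ℝ → ℝ → ℝ, ∀ t : ℝ, 1 ≤ t → t ≤ 2 →
    (∀ a₀ : ℝ, 0 < a₀ → ∀ ε : ℝ, 0 < ε → ∀ᶠ X : ℕ in atTop, ∀ a b : ℝ, a₀ ≤ a → a ≤ b → b ≤ 1 →
        |modelMean X ((X : ℝ) ^ a) ((X : ℝ) ^ b) t - C a b t| ≤ ε) ∧
    Tendsto (fun q : ℝ × ℝ => q.1 ^ (t - 1) * C q.1 q.2 t)
      (𝓝[{q : ℝ × ℝ | 0 < q.1 ∧ q.1 ≤ q.2 ∧ q.2 ≤ 1}] ((0 : ℝ), (1 : ℝ)))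
      (𝓝 (Real.exp (-(Real.eulerMascheroniConstant * (t - 1))) / Real.Gamma t))

/-- `KPD k f` — THE SHARED KERNEL (Poisson–Dirichlet kernel in integer-model comparison form, law level,
`y`-free, cap-free in its hypotheses). [VERBATIM sibling] -/
def KPD (k : ℕ) (f : Fin k → ℤ[X]) : Prop :=
  ∃ η₀ : ℝ, 0 < η₀ ∧ ∀ θ η κ : ℝ, 0 < θ → θ < η → η ≤ η₀ → 0 < κ → κ ≤ η₀ →
    ∀ ε : ℝ, 0 < ε → ∀ᶠ x : ℕ in atTop, ∀ d ∈ admissible k θ η x, ∀ j : ℕ,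
      |(#((divClass f d x).filter fun n : ℕ => sysWindowCount f θ κ x n = j) : ℝ) -
          (#(divClass f d x) : ℝ) *
            modelLaw (fun i => ⌊(x : ℝ) ^ ((f i).natDegree : ℝ) / (d i : ℝ)⌋₊) ((x : ℝ) ^ θ)
              (fun i => (x : ℝ) ^ (((f i).natDegree : ℝ) - κ)) j| ≤
        ε * (#(divClass f d x) : ℝ)

/-! ### Objects of the line, II — the un-capped side -/

/-- The crux's statistic `Ω_f(n) = Σᵢ Ω(fᵢ(n))` (values `≤ 0 ↦ 0`), verbatim the crux's exponent. [folklore] -/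
def sysOmega {k : ℕ} (f : Fin k → ℤ[X]) (n : ℕ) : ℕ :=
  ∑ i, cardFactors (val f i n)

section Weights

variable {R : Type*} [CommRing R]

/-- Local coefficients of the UN-capped divisor weight `g_t = μ ⋆ t^{Ω}`: `g_t(p⁰) = 1`,
`g_t(p^{ν+1}) = t^ν (t − 1)` for EVERY `ν` (no cap; all `≥ 0` for real `t ≥ 1`). [folklore] -/
def gCoeff (t : R) : ℕ → R
  | 0 => 1
  | ν + 1 => t ^ ν * (t - 1)

@[simp] theorem gCoeff_zero (t : R) : gCoeff t 0 = 1 := rfl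

theorem gCoeff_succ (t : R) (ν : ℕ) : gCoeff t (ν + 1) = t ^ ν * (t - 1) := rfl

/-- THE UN-CAPPED DIVISOR WEIGHT `g_t(d) = ∏_{p^v ∥ d} gCoeff t v = (t−1)^{ω(d)} t^{Ω(d)−ω(d)}`: multiplicative,
supported on ALL `d ≥ 1`; `t^{Ω(m)} = Σ_{d ∣ m} g_t(d)` (`pow_cardFactors_eq_sum_divisors`). [folklore] -/
def gWeight (t : R) (d : ℕ) : R := d.factorization.prod fun _ v => gCoeff t v

theorem gWeight_one (t : R) : gWeight t 1 = 1 := by simp [gWeight]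

theorem gWeight_prime_pow (t : R) {p : ℕ} (hp : p.Prime) (j : ℕ) : gWeight t (p ^ j) = gCoeff t j := by
  rw [gWeight, hp.factorization_pow, Finsupp.prod_single_index]
  exact gCoeff_zero t

theorem gWeight_mul (t : R) {m n : ℕ} (hm : m ≠ 0) (hn : n ≠ 0) (h : m.Coprime n) :
    gWeight t (m * n) = gWeight t m * gWeight t n := by
  unfold gWeight
  rw [Nat.factorization_mul hm hn, Finsupp.prod_add_index_of_disjoint]
  simpa only [Nat.support_factorization] using h.disjoint_primeFactors

/-- Telescoping: `Σ_{i ≤ j} gCoeff t i = t^j` — the local form of the un-capped expansion. [folklore] -/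
theorem sum_gCoeff_range (t : R) (j : ℕ) : ∑ i ∈ range (j + 1), gCoeff t i = t ^ j := by
  induction j with
  | zero => simp
  | succ j ih => rw [Finset.sum_range_succ, ih, gCoeff_succ]; ring

end Weights

/-- `gCoeff t ν ≥ 0` for real `t ≥ 1`. [folklore] -/
theorem gCoeff_nonneg {t : ℝ} (ht : 1 ≤ t) : ∀ ν : ℕ, 0 ≤ gCoeff t ν
  | 0 => by simp
  | ν + 1 => by
    rw [gCoeff_succ]
    exact mul_nonneg (pow_nonneg (by linarith) _) (by linarith)

/-- `g_t ≥ 0` for real `t ≥ 1`. [folklore] -/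
theorem gWeight_nonneg {t : ℝ} (ht : 1 ≤ t) (d : ℕ) : 0 ≤ gWeight t d := by
  unfold gWeight Finsupp.prod
  exact Finset.prod_nonneg fun p _ => gCoeff_nonneg ht (d.factorization p)

/-- Local density of the EXACT `p`-adic order of the value product: `densOmega f p ν = P(p^ν ∥ ∏ᵢ fᵢ(n))`,
computed over one period `n mod p^{ν+1}` (exact; integer roots of `∏ fᵢ` have density `0` and are in no class).
[folklore] -/
def densOmega {k : ℕ} (f : Fin k → ℤ[X]) (p ν : ℕ) : ℝ :=
  (#((range (p ^ (ν + 1))).filter fun n : ℕ =>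
      ((p : ℤ) ^ ν ∣ ∏ i, (f i).eval (n : ℤ)) ∧ ¬ ((p : ℤ) ^ (ν + 1) ∣ ∏ i, (f i).eval (n : ℤ))) : ℝ) /
    (p : ℝ) ^ (ν + 1)

/-- The UN-capped local factor `E_p^Ω(z) = Σ_ν densOmega f p ν · z^ν` — a POWER SERIES of radius `≥ p`
(junk `0` where not summable; used only on `‖z‖ < 2 ≤ p`). `E_p^Ω(0) = 1 − ω_f(p)/p`, `E_p^Ω(1) = 1`;
`f = X`: `(1 − 1/p)/(1 − z/p)`; twins: `E_2^Ω = ½ + z³/(2(2−z))`. [folklore] -/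
def localFactorOmega {k : ℕ} (f : Fin k → ℤ[X]) (p : ℕ) (z : ℂ) : ℂ :=
  ∑' ν : ℕ, (densOmega f p ν : ℂ) * z ^ ν

/-- The same local factor at a real argument, as a real series. [folklore] -/
def localFactorOmegaR {k : ℕ} (f : Fin k → ℤ[X]) (p : ℕ) (t : ℝ) : ℝ :=
  ∑' ν : ℕ, densOmega f p ν * t ^ ν

/-- Ordered partial Euler product `λ^Ω_{f,N}(z) = ∏_{p ≤ N} E_p^Ω(z) (1 − 1/p)^{k(z−1)}`
(`(1−1/p)^{k(z−1)} = exp(k(z−1) log(1−1/p))`, as in `Theorems/AlmostPrimeZerosDefs.eulerFactor`). [folklore] -/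
def eulerPartialOmega {k : ℕ} (f : Fin k → ℤ[X]) (N : ℕ) (z : ℂ) : ℂ :=
  ∏ p ∈ Nat.primesLE N, localFactorOmega f p z * Complex.exp ((k : ℂ) * (z - 1) * (Real.log (1 - 1 / (p : ℝ)) : ℂ))

/-- `λ_f^Ω(z) := lim_N λ^Ω_{f,N}(z)` — the line's explicit `Λ` (ordered limit; junk where divergent). [folklore] -/
def eulerFactorOmega {k : ℕ} (f : Fin k → ℤ[X]) (z : ℂ) : ℂ :=
  limUnder atTop fun N : ℕ => eulerPartialOmega f N z

/-! ### Statements of the line (named, so that the composition is literal) -/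

/-- `EulerFactorLawOmega k f` — the un-capped Euler factor, ON THE OPEN BALL ONLY:
(a) bounded root counts modulo prime powers: `densOmega f p ν ≤ C p^{−ν}` for all primes `p` and all `ν`;
(b) the ordered partial products converge at every `|z| < 2` to `eulerFactorOmega f z`;
(c) `eulerFactorOmega f` is holomorphic on `|z| < 2`; (d) `λ(0) = batemanHornConst f`; (e) `λ(1) = 1`;
(f) `λ(t)` is real `> 0` for real `0 < t < 2`. [folklore] -/
def EulerFactorLawOmega (k : ℕ) (f : Fin k → ℤ[X]) : Prop :=
  (∃ C : ℝ, ∀ p : ℕ, p.Prime → ∀ ν : ℕ, densOmega f p ν ≤ C / (p : ℝ) ^ ν) ∧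
  (∀ z ∈ Metric.ball (0 : ℂ) 2, Tendsto (fun N : ℕ => eulerPartialOmega f N z) atTop (𝓝 (eulerFactorOmega f z))) ∧
  DifferentiableOn ℂ (eulerFactorOmega f) (Metric.ball 0 2) ∧
  eulerFactorOmega f 0 = (batemanHornConst f : ℂ) ∧ eulerFactorOmega f 1 = 1 ∧
  ∀ t : ℝ, 0 < t → t < 2 → ∃ r : ℝ, 0 < r ∧ eulerFactorOmega f (t : ℂ) = (r : ℂ)

/-- `SmallPrimeSumOmega k f` — the LEVEL-FREE small-prime expansion with UNBOUNDED prime powers: for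
`1 ≤ t < 2` and `ε > 0` there is `R` such that whenever `0 < θ`, `Rθ ≤ η ≤ 1/2`, eventually in `x`:
`|Σ_{d admissible} g_t(d) #A_d(x) − x ∏_{p ≤ x^θ} E_p^Ω(t)| ≤ ε x ∏_{p ≤ x^θ} E_p^Ω(t)` (`g_t(d) = ∏ᵢ g_t(dᵢ)`).
[folklore] -/
def SmallPrimeSumOmega (k : ℕ) (f : Fin k → ℤ[X]) : Prop :=
  ∀ t : ℝ, 1 ≤ t → t < 2 → ∀ ε : ℝ, 0 < ε → ∃ R : ℝ, 0 < R ∧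
    ∀ θ η : ℝ, 0 < θ → R * θ ≤ η → η ≤ 1 / 2 →
      ∀ᶠ x : ℕ in atTop,
        |(∑ d ∈ admissible k θ η x, (∏ i, gWeight t (d i)) * (#(divClass f d x) : ℝ)) -
            (x : ℝ) * ∏ p ∈ Nat.primesLE ⌊(x : ℝ) ^ θ⌋₊, localFactorOmegaR f p t| ≤
          ε * ((x : ℝ) * ∏ p ∈ Nat.primesLE ⌊(x : ℝ) ^ θ⌋₊, localFactorOmegaR f p t)

/-- `SpikeControl k f` — NO p-ADIC SPIKES (Ridout 1958 / Bugeaud–Evertse–Győry 2018 Thm 2.1(i) for the squarefree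
`F = ∏ fᵢ`): for every `P` and `ε > 0`, eventually in `n`, the `P`-smooth part of `∏ᵢ fᵢ(n)` is `≤ n^{1+ε}`.
(Any exponent `< 1/log₂(7/4) = 1.2386…` would serve the line; `1` is forced from below by a linear member.)
[folklore] -/
def SpikeControl (k : ℕ) (f : Fin k → ℤ[X]) : Prop :=
  ∀ P : ℕ, ∀ ε : ℝ, 0 < ε → ∀ᶠ n : ℕ in atTop,
    (∏ p ∈ Nat.primesLE P, ((p : ℝ) ^ padicValNat p (∏ i, val f i n))) ≤ (n : ℝ) ^ (1 + ε)

/-- `TiltedTailsOmega k f` — three tilted UPPER bounds for the un-capped weight over LONG sums `n ≤ x` (all values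
positive), for `1 ≤ t < 2`:
(o) order of magnitude (the repaired `UncappedShortIntervalBound`, `h = x`): `Σ_{n ≤ x} t^{Ω_f(n)} ≤ C x (log x)^{k(t−1)}`;
(a) smooth tail — for `ε > 0` there is `R` such that for `0 < θ`, `Rθ ≤ η ≤ 1/2`, eventually
`Σ_{n : ∏ᵢ smoothPart_{x^θ}(fᵢ(n)) > x^η} t^{Ω_f(n)} ≤ ε x (log x)^{k(t−1)}`;
(b) top class — there is `K` such that for `0 < κ ≤ 1/2`, eventually
`Σ_{n : some fᵢ(n) has a prime factor > x^{deg fᵢ − κ}} t^{Ω_f(n)} ≤ K κ x (log x)^{k(t−1)}`. [folklore] -/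
def TiltedTailsOmega (k : ℕ) (f : Fin k → ℤ[X]) : Prop :=
  (∀ t : ℝ, 1 ≤ t → t < 2 → ∃ C : ℝ, ∀ᶠ x : ℕ in atTop,
      (∑ n ∈ range (x + 1), t ^ sysOmega f n) ≤ C * ((x : ℝ) * Real.log x ^ ((k : ℝ) * (t - 1)))) ∧
  (∀ t : ℝ, 1 ≤ t → t < 2 → ∀ ε : ℝ, 0 < ε → ∃ R : ℝ, 0 < R ∧
      ∀ θ η : ℝ, 0 < θ → R * θ ≤ η → η ≤ 1 / 2 →
        ∀ᶠ x : ℕ in atTop,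
          (∑ n ∈ (range (x + 1)).filter (fun n : ℕ => (∀ i, 0 < (f i).eval (n : ℤ)) ∧
              (x : ℝ) ^ η < ∏ i, (smoothPart ((x : ℝ) ^ θ) (val f i n) : ℝ)),
            t ^ sysOmega f n) ≤ ε * ((x : ℝ) * Real.log x ^ ((k : ℝ) * (t - 1)))) ∧
  (∀ t : ℝ, 1 ≤ t → t < 2 → ∃ K : ℝ, ∀ κ : ℝ, 0 < κ → κ ≤ 1 / 2 →
      ∀ᶠ x : ℕ in atTop,
        (∑ n ∈ (range (x + 1)).filter (fun n : ℕ => (∀ i, 0 < (f i).eval (n : ℤ)) ∧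
            ∃ i, ∃ p ∈ (val f i n).primeFactors, (x : ℝ) ^ (((f i).natDegree : ℝ) - κ) < (p : ℝ)),
          t ^ sysOmega f n) ≤ K * κ * ((x : ℝ) * Real.log x ^ ((k : ℝ) * (t - 1))))

/-- `CubeFreeTailOmega k f` — CUBE-FULL VALUES AT LARGE PRIMES CARRY NO TILTED MASS: for `1 ≤ t < 2`, `θ > 0`,
`ε > 0`, eventually `Σ_{n ≤ x : p³ ∣ fᵢ(n) for some i and some prime p > x^θ} t^{Ω_f(n)} ≤ ε x (log x)^{k(t−1)}`.
(The set where the capped window count of `KPD` differs from the true `Ω`-count.) [folklore] -/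
def CubeFreeTailOmega (k : ℕ) (f : Fin k → ℤ[X]) : Prop :=
  ∀ t : ℝ, 1 ≤ t → t < 2 → ∀ θ : ℝ, 0 < θ → ∀ ε : ℝ, 0 < ε →
    ∀ᶠ x : ℕ in atTop,
      (∑ n ∈ (range (x + 1)).filter (fun n : ℕ => (∀ i, 0 < (f i).eval (n : ℤ)) ∧
          ∃ i, ∃ p ∈ (val f i n).primeFactors, (x : ℝ) ^ θ < (p : ℝ) ∧ p ^ 3 ∣ val f i n),
        t ^ sysOmega f n) ≤ ε * ((x : ℝ) * Real.log x ^ ((k : ℝ) * (t - 1)))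

/-- `SegmentLawAt k f Λ y`: the crux's real-segment convergence for ONE `(k, f)`, ONE `y` and a GIVEN `Λ`
(the crux's `Tendsto` clause verbatim). [folklore] -/
def SegmentLawAt (k : ℕ) (f : Fin k → ℤ[X]) (Λ : ℂ → ℂ) (y : ℝ) : Prop :=
  Filter.Tendsto (fun x : ℕ => (x : ℂ)⁻¹ * Complex.exp ((k : ℂ) * (1 - (y : ℂ)) * (Real.log (Real.log x) : ℂ)) *
    ∑ n ∈ Finset.range (x + 1), (y : ℂ) ^ (∑ i, ArithmeticFunction.cardFactors (((f i).eval (n : ℤ)).toNat)))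
    Filter.atTop (nhds (Λ y * Complex.exp (((y : ℂ) - 1) * (Real.log (∏ i, ((f i).natDegree : ℝ)) : ℂ)) *
      (Complex.Gamma y)⁻¹ ^ k))

/-! ### The registered stubs -/

/-- **stub_localEulerOmega** (provable now; size M+M — analytic and arithmetic Euler bookkeeping of the UN-capped
local factors).  (a) `densOmega f p ν = (ρ_F(p^ν) p − ρ_F(p^{ν+1}))/p^{ν+1} ≤ ρ_F(p^ν)/p^ν` with `F = ∏ fᵢ`
squarefree (irreducible, pairwise non-associated): for `p ∤ lc·disc F` Hensel gives `ρ_F(p^ν) = ρ_F(p) ≤ deg F`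
(`IsBatemanHornSystem.exists_localCounts` is the `ν = 2` large-`p` case already in the tree); at the finitely many
bad primes `ρ_F(p^ν)` is bounded in `ν` (Huxley 1981 / Stewart 1991, JAMS 4, Thm 2: `≤ deg F · p^{v_p(disc)/2}`-type;
elementary for fixed `F`: each `ℤ_p`-root neighbourhood contributes boundedly once `ν > v_p(disc F)`).
(b)–(c) Write `E_p^Ω(z) = E_p^{cap}(z) + Σ_{ν ≥ 3} densOmega·(z^ν − z²)`… more simply: for `p > P₀`,
`E_p^Ω(z) = 1 + (z−1)ω_f(p)/p + O(C|z|²p^{−2}/(1 − |z|/p))` on `|z| < 2 ≤ p`, so with `log(1−1/p) = −1/p + O(p⁻²)`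
the `p`-th factor is `exp((z−1)(ω_f(p)−k)/p)(1 + O_r(p⁻²))` uniformly on `|z| ≤ r < 2`; the ORDERED sum
`Σ_p (ω_f(p) − k)/p` converges (`AZFG2020_tendsto_sum_sub_omega_div_holds`, PROVED), the `O(p⁻²)` part converges
absolutely (`Summable.hasProdLocallyUniformlyOn_one_add` pattern of the landed capped proof
`Theorems/AlmostPrimeZerosSystemLSDRealSegmentEulerFactor.stub_eulerFactor`), each partial product is holomorphic
on the ball (power series of radius `≥ p ≥ 2` times entire), hence locally uniform convergence on `ball 0 2`,
`limUnder` = the limit, holomorphic (`TendstoLocallyUniformlyOn.differentiableOn`).  NOT entire: radius of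
`E_2^Ω` is exactly `2` whenever some `fᵢ` has a root in `ℤ₂` (`Negative.SharpRadius` at `f = X`).
(d) `z = 0`: `0^ν = [ν = 0]`, `densOmega f p 0 = 1 − ω_f(p)/p` (`polyRootCountMod`), so the `N`-th partial
product IS `(batemanHornPartial f N : ℂ)` and `IsBatemanHornSystem.hasBatemanHornConst_holds` (PROVED) identifies
the limit.  (e) `z = 1`: `Σ_ν densOmega f p ν = 1` (bounded root counts ⇒ `P(p^ν ∣ F(n)) → 0`).  (f) real
`0 < t < 2`: every factor is a positive real (`densOmega ≥ 0`, `densOmega f p 0 > 0` fails only if `ω_f(p) = p`,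
excluded by `hasNoFixedPrimeDivisor`… NOT needed: if `ω_f(p) = p` then `C(f) = 0` and (d) still holds; for (f) use
`E_p^Ω(t) ≥ densOmega f p 1 · t > 0` or `E_p(t) ≥ t^0·P(p ∤ F) + … = E[t^{v_p}] > 0` as an expectation of a
positive quantity), and the log-series converges.
SMALL PRIMES (second conjunct; complete periods, NO equidistribution input): `#A_d(x) = x g_f(d) + O(ν_f(d)) + O(n₀)`,
`g_f(d)` = density of `{n : dᵢ ∣ fᵢ(n) ∀ i}` (union of `ν_f(d) ≤ g_f(d)·lcm(d)` classes mod `lcm(dᵢ) ≤ ∏dᵢ ≤ x^η ≤ √x`),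
`g_f` CRT-multiplicative over prime-power tuples with
`Σ_{e ∈ ℕ^k} ∏ᵢ g_t(p^{eᵢ}) g_f(p^e) = E_n[∏ᵢ Σ_{eᵢ ≤ v_p(fᵢ(n))} g_t(p^{eᵢ})] = E_n[t^{Σᵢ v_p(fᵢ(n))}] = E_p^Ω(t)`
(`sum_gCoeff_range`; monotone convergence, finite since `densOmega ≤ C p^{−ν}` and `t < 2 ≤ p`), so the FULL
smooth sum is `∏_{p ≤ x^θ} E_p^Ω(t)`; the part `∏dᵢ > x^η` is handled by Rankin with `σ = 1/(θ log x)`: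
`≤ e^{−η/θ} ∏_p E_p^{Ω,(σ)}(t)`, where now `E_2^{Ω,(σ)}(t) ∋ Σ_ν (t 2^{σ−1})^ν`, finite iff `t 2^{σ} < 2` — true
for `x` large BECAUSE `t < 2` (the second named use of `y < 2`); error terms `≤ x^{η+o(1)} ∏E_p = o(x∏E_p)` since
`g_t(dᵢ) ≤ dᵢ^{log₂ t}·2^{ω(dᵢ)}` and `#admissible ≤ x^{η}(log x)^k`.  Take `R = log(1/ε)/c + O_{f,t}(1)`. -/
theorem stub_localEulerOmega :
    ∀ (k : ℕ) (f : Fin k → ℤ[X]), IsBatemanHornSystem f → EulerFactorLawOmega k f ∧ SmallPrimeSumOmega k f := by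
  sorry

/-- **stub_integerEwens** (provable now; size M–L; pure integers + real analysis) — VERBATIM the sibling line's
registered stub (`Cruxes/SystemLSDRealSegment/Lines/ewens-pd-kernel.lean`, stmt-Parity-11292): one proof serves
both cruxes.  (i) Factorial moments of the windowed count of a uniform `m ≤ X` via Mertens
(`Literature.NumberTheory.LFunctions.Mertens.tendsto_primeRecipSum_sub_loglog`, PROVED) → `J_j(a,b)`, squares
`p² ∣ m`, `p > X^a` negligible, `modelMean → C(a,b,t) = Σ_j (t−1)^j J_j(a,b)/j!`, uniformly on `a₀ ≤ a ≤ b ≤ 1`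
(monotonicity in the window + continuity); (ii) the corner: `a^{t−1}C(a,1,t) → e^{−γ(t−1)}/Γ(t)` from
Selberg–Delange on ℕ (`MontgomeryVaughan2007_thm_7_18_holds`, PROVED) against Mertens' third theorem
(`…Mertens.tendsto_log_mul_prod_one_sub_inv`, PROVED); the sliver `(b,1]` costs `O((1−b)a^{1−t})`. -/
theorem stub_integerEwens : IntegerEwens := by
  sorry

/-- **stub_spikeControl** (a THEOREM in print, deep and ineffective; to VENDOR as a Literature fact, then one
line here): Bugeaud–Evertse–Győry, Acta Arith. 184 (2018) [BugeaudEvertseGyory2018] Thm 2.1(i) (= Mahler/Ridout's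
p-adic Thue–Siegel–Roth [Ridout1958]; B–G Thm 6.2.3): for `F ∈ ℤ[X]` of degree `T ≥ 2` WITHOUT MULTIPLE ZEROS,
finite `S`, `ε > 0`: `[F(x)]_S ≪_{F,S,ε} |F(x)|^{1/T+ε}`; their proof gives directly
`|F(x)|/[F(x)]_S ≫ |x|^{T−1−Tε}`, i.e. `[F(n)]_S ≪ n^{1+Tε}`, and the constant is absorbed by `∀ᶠ` after
shrinking `ε`.  Apply to `F = ∏ᵢ fᵢ` (`T = Σ deg fᵢ`): squarefree because the `fᵢ` are irreducible over `ℚ`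
(separable) and pairwise non-associated (coprime) — EXACTLY `Negative.LoadBearing`'s two load-bearing fields
(for `![X^2]` or `![X, X]`, `[n²]₂ = n² > n^{1+ε}` at `n = 2^a`: the statement is false there).  Degenerate
cases: `k = 0` (`F = 1`, product `= 1`), `T = 1` (`[an+b]_S ≤ an+b ≤ n^{1+ε}`) are elementary; for `n ≥ n₀(f)`
all values are positive so `∏ val = (∏ fᵢ(n)).toNat` (`leadingCoeff_pos`).  In-tree route to a `_holds`: the
`Literature/NumberTheory/DiophantineApproximation/Subspace*` project (p-adic Subspace over `ℚ`) specialised to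
one linear form in two variables is Ridout's theorem.  What the line CONSUMES is only an exponent `β` with
`β·log₂ t < 1`, i.e. `β < 1.2386` at `t = 7/4` (fourth named use of `y < 2`: `β ≥ 1` is forced by any linear
member, so `log₂ t < 1`). -/
theorem stub_spikeControl :
    ∀ (k : ℕ) (f : Fin k → ℤ[X]), IsBatemanHornSystem f → SpikeControl k f := by
  sorry

/-- **stub_peeledTails** (size L; needs a VENDORED fact — Nair–Tenenbaum 1998 Acta Math. 180 Thm 1
[NairTenenbaum1998] / Henriot 2012 [Henriot2012] Thm 3: `Σ_{x<n≤x+y} G(|f₁(n)|,…,|f_k(n)|) ≪ y ∏_{p≤x}(1−ω_f(p)/p)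
Σ_{n₁⋯n_k ≤ x} G(n)ρ̃(n)/n` for `G` in the class `M` (sub-multiplicative, `G(n) ≪_ε n^ε`), uniformly in
progressions of modulus `≤ x^{1−ε}` — applied ONLY to the PEELED weight, plus `SpikeControl` for the rest).
The un-capped tilt `t^{Ω}` is NOT in `M` (`t^{Ω(2^ν)} = (2^ν)^{log₂ t}`; Hall–Tenenbaum *Divisors* Thm 03 vs 04),
so: fix `P = P(δ)` and PEEL, `t^{Ω_f(n)} = t^{Σ_{p ≤ P} v_p(F(n))} · t^{Ω_{>P}(F(n))}`; the second factor IS in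
`M(t, log t/log P)` and Nair–Tenenbaum/Henriot bound its long sums (in progressions `e ∣ fᵢ(n)`, `e ≤ x^{1−ε}`)
by `≪ x (log x)^{k(t−1)} · (local factors)`; the first factor is handled by splitting `n ≤ x` into
(α) `[F(n)]_{≤P} ≤ x^{1−δ}`: complete periods modulo `∏_{p≤P} p^{ν_p} ≤ x^{1−δ}` with weights `t^{Σν_p}` against
densities `≤ C ∏ p^{−ν_p}` — the series `Σ_ν (t/p)^ν` converge iff `t < p`, i.e. BECAUSE `t < 2` (third named use
of `y < 2`) — and (β) `[F(n)]_{≤P} > x^{1−δ}`: at most `O_P(x^{δ} (log x)^{P})` integers `n ≤ x` (each pattern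
`(ν_p)_{p≤P}` with `∏p^{ν_p} > x^{1−δ}` is `≤ C` residue classes of modulus `> x^{1−δ}`), each of weight
`t^{Ω_f(n)} ≤ t^{(1+ε)log₂ n} · x^{T log t/log P} ≤ x^{(1+ε)log₂ t + δ'}` by `SpikeControl` (all small-prime mass at
`p = 2` is the worst case) — negligible iff `(1+ε) log₂ t + δ + δ' < 1`, the FOURTH named use of `y < 2`
(triage r1-1 F0(b)).  With this dictionary the three clauses are the sibling's `stub_tiltedTails` arguments:
(o) the plain long-sum bound (the REPAIRED `UncappedShortIntervalBound`: `h = x`; the short-interval version is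
false below `h = x^{log₂ t}`, `TriageR1K2StubsFalse.not_uncappedShortIntervalBound`); (a) canonical `x^θ`-smooth
divisor `e ∥ fᵢ(n)` in `(x^{η/k}, x^{η/k+2θ}]` when every prime power `p^{v} ∥ fᵢ(n)`, `p ≤ x^θ`, is `≤ x^{2θ}`
(else `p³ ∣ fᵢ(n)` with `p^{v} > x^{2θ}`: `≪ x^{1−θ}` integers, Hölder with (o) at `t^q < 2`), N–T in the class
`e ∣ fᵢ(n)`, Rankin over `e` with `σ = 1/(θ log x)` (`Σ_ν (t p^{σ−1})^ν < ∞` at `p = 2` for `x` large, again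
`t < 2`): relative saving `exp(−cη/(kθ))`; (b) top class `fᵢ(n) = m p`, `m ≤ A x^κ`, upper-bound sieve of
dimension 1 for `fᵢ(n)/m` prime in the class `m ∣ fᵢ(n)` (`SieveSequence.fundamental_lemma_uniform_holds`
pattern) with spectator tilts by peeled N–T: `≪ t Σ_{m ≤ Ax^κ} t^{Ω(m)}ρᵢ(m)/m · x(log x)^{k(t−1)}/log x ≪ κ^t ·
x (log x)^{k(t−1)}` (`m = 2^a` terms: `Σ_a (t/2)^a < ∞`).  Positivity (`t ≥ 1`) essential; no lower bound,
no parity. -/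
theorem stub_peeledTails :
    ∀ (k : ℕ) (f : Fin k → ℤ[X]), IsBatemanHornSystem f → SpikeControl k f → TiltedTailsOmega k f := by
  sorry

/-- **stub_cubeFreeTail** (provable now for systems all of whose members have degree `≤ 3`; degree `4` needs a
Hooley-1967-type power-free-values input with a saving `(log x)^{−A}` for every `A`; degree `≥ 5` is OPEN —
cube-free values of quintics at primes `p > x` are beyond Erdős 1953 / Hooley 1967 / Heath-Brown–Browning
determinant-method ranges; this is precisely the content by which the un-capped crux exceeds the capped sibling,
triage r1-3 N2, isolated here so that `stub_kpd` stays literally the sibling's and no open problem hides in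
`stub_peeledTails`).  Route for a member `fᵢ` of degree `dᵢ`: the COUNT
`B(x) = #{n ≤ x : ∃ p > x^θ, p³ ∣ fᵢ(n)}` satisfies `B(x) ≤ Σ_{x^θ < p ≤ (A x^{dᵢ})^{1/3}} ρᵢ(p³)(x/p³ + 1)
≪ x^{1−2θ} + x^{dᵢ/3}/log x` (Hensel: `ρᵢ(p³) ≤ dᵢ` for `p ∤ disc`), a power saving for `dᵢ ≤ 2`; for `dᵢ = 3`
the range `p > x^{1/3+δ}`… `p³ > A' x^{1+3δ}` forces `fᵢ(n) = p³ m` with `m ≤ A x^{2−3δ}`— use instead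
`p > (Ax³)^{1/3}/x^{δ}`: then `m ≤ x^{3δ}` and for each `m` the `n ≤ x` with `fᵢ(n) = m q³` are `≪ x^{1/3+ε}`
(Bombieri–Pila [BombieriPila1989] on the irreducible cubic curve `m Y³ = fᵢ(X)`, or Siegel finiteness for fixed
`m`), total `x^{1/3+3δ+ε}`; so `B(x) ≤ x^{1−δ'}` for `dᵢ ≤ 3`.  Then Hölder with clause (o) of `TiltedTailsOmega`
at `u = t^q < 2` (`q > 1`): `Σ_{n ∈ B} t^{Ω_f(n)} ≤ B(x)^{1−1/q} (C x (log x)^{k(t^q−1)})^{1/q} = o(x)`.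
For `dᵢ ≥ 4` the count `B(x) = o(x)` is `(dᵢ−1)`-free values of `fᵢ` at large primes (Hooley 1967 for `dᵢ = 4`,
saving a small power of `log x` — insufficient for Hölder as it stands; open for `dᵢ ≥ 5`). -/
theorem stub_cubeFreeTail :
    ∀ (k : ℕ) (f : Fin k → ℤ[X]), IsBatemanHornSystem f → TiltedTailsOmega k f → CubeFreeTailOmega k f := by
  sorry

/-- **stub_kpd** — THE KERNEL (OPEN; hardest; the line's single load-bearing beyond-level input; `y`-free) —
VERBATIM the sibling line's registered stub `EwensPdKernel.stub_kpd` (stmt-Parity-11292): ONE staffing target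
for two cruxes.  Conditionally on `dᵢ ∣ fᵢ(n)` (`d` admissible: `x^θ`-smooth, `∏dᵢ ≤ x^η`) the capped counts of
prime factors of the `fᵢ(n)` in `(x^θ, x^{deg fᵢ−κ}]` are jointly distributed, at law level up to `ε #A_d(x)`,
like those of INDEPENDENT uniform integers `mᵢ ≤ ⌊x^{deg fᵢ}/dᵢ⌋` (Poisson–Dirichlet PD(1) per coordinate;
independence = `pairwise_not_associated`, FALSE for `(X, X)` — `Negative.LoadBearing`).  By moments = ROOT COUNTS
of `F = ∏fᵢ` to structured moduli `lcm(d)·p₁⋯p_r` counted in `[0, x]`: sub-critical for `Σ log pⱼ ≤ (1−δ)log x`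
(complete periods), the macroscopic slice certified by `dukeFriedlanderIwaniecToth_quadraticRoots_primeModuli` /
`hooley_polyRoots_equidistributed` (fixed frequency), super-critical beyond (Merikoski arXiv:1908.08816 §4:
bounds only); for `Σ deg ≤ 2` the informative rows are smooth-moduli rows below `x^{2−θ}` (cards
cheap-patterns-smooth-moduli / twin-three-regime-map price them: DFI 1997 in tree ⇒ θ < 107/106 for linear pairs);
for `Σ deg fᵢ ≥ 3` or `k ≥ 2` most mass is super-critical and the `j = 0` marginal at `d = 1` is Bateman–Horn for
the cofactor families averaged over `x^{O(κ)}`-smooth twists (triage r1-1 (B), r1-3 N1) — BH-on-average hard,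
honestly.  Implied by uniform Bateman–Horn for the cofactor families (Martin 2002 [Martin2002SmoothPolynomialValues]).
First milestones: `f = X` (TRUE: exact model up to the floor); `X²+1`, `j`-law at `d = 1` (falsifier
`#{n ≤ x : P⁺(n²+1) > x}/x → log 2`, kit j006851: `0.6696 → 0.6803` at `10⁴…3·10⁶`, deficit `≍ 0.19/log x`). -/
theorem stub_kpd :
    ∀ (k : ℕ) (f : Fin k → ℤ[X]), IsBatemanHornSystem f → KPD k f := by
  sorry

/-- **stub_spliceOmega** — the Ewens bookkeeping (provable now GIVEN the six inputs; size M; real analysis and exact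
identities, no arithmetic beyond Mertens).  For `k, f`, `y = t ∈ (5/4, 7/4)`: (0) drop the `n < n₀(f)` with a
non-positive value (`O(1)` terms; for `k = 0` everything is constant and `λ_∅^Ω ≡ 1`, `Negative.LoadBearing.
lsdRealSegment_fin_zero`); (1) EXACT EXPANSION of the small primes, `t^{Ω_f(n)} = t^{Ω^{>x^θ}_f(n)} Σ_{d ∣ f(n),
x^θ-smooth tuple} g_t(d)` (`pow_cardFactors_eq_sum_divisors`, `g_t ≥ 0`); (2) SANDWICH:
`S_adm ≤ S(x) ≤ S_adm + Tail(θ,η) + Top(κ) + Cube(θ)` with `S_adm := Σ_{d adm} g_t(d) Σ_{n ∈ A_d} t^{N_w(n)}`,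
`N_w = sysWindowCount` (CAPPED, the kernel's): lower bound because `Ω^{>x^θ} ≥ N_w` and dropping non-admissible
`d` only decreases; upper bound because off Top ∪ Cube the un-capped large-prime count IS `N_w` (no prime above
the window, no window prime to the third power, squares counted twice by both), and if `∏ smᵢ(n) ≤ x^η` every
smooth tuple-divisor is admissible; (3) KPD (law) ⇒ `|Σ_{A_d} t^{N_w} − #A_d Σ_j t^j P_model(j)| ≤ ε(Σ_{j≤J} t^j)#A_d`,
`J = J(θ,f)` a uniform bound for `N_w` on both sides; `Σ_j t^j P_model(j) = ∏ᵢ modelMean Xᵢ x^θ x^{dᵢ−κ} t`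
(product over `Fintype.piFinset`); (4) `IntegerEwens` (i) at `Xᵢ = ⌊x^{dᵢ}/dᵢ⌋ → ∞`, `a = θ log x/log Xᵢ`,
`b = (dᵢ−κ)log x/log Xᵢ ∈ [1 − κ/dᵢ, 1]` (needs `η ≤ κ`), then `SmallPrimeSumOmega` for `Σ_d g_t(d)#A_d`;
(5) LIMITS: `x → ∞` at fixed `(θ,η,κ)` brackets `H_x(t)` within `[(1−ε)³m, (1+ε)³M + ε + Kκ + ε]·(θ log x)^{−k(t−1)}
∏_{p≤x^θ}E_p^Ω(t)(log x)^{…}`, `m, M = inf/sup ∏ᵢ C(aᵢ,bᵢ,t)`; Mertens' third theorem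
(`Literature.NumberTheory.LFunctions.Mertens.tendsto_log_mul_prod_one_sub_inv`, PROVED) and `EulerFactorLawOmega`
(b) at `z = t` give `(θ log x)^{−k(t−1)} ∏_{p ≤ x^θ} E_p^Ω(t) → λ_f^Ω(t) e^{γk(t−1)}` (`localFactorOmega f p t =
localFactorOmegaR f p t` by `Complex.ofReal_tsum`); finally `κ → 0` with `η = κ`, `θ = κ/R`: `IntegerEwens` (ii)
gives `θ^{t−1}C(aᵢ,bᵢ,t) → dᵢ^{t−1}e^{−γ(t−1)}/Γ(t)` uniformly on the box, so the bracket tends to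
`λ_f^Ω(t) D^{t−1} Γ(t)^{−k}` (`e^{±γ}`, `θ` cancel identically); (6) real → complex
(`Negative.Engines.tendsto_ofReal_of_tendsto`, `λ_f^Ω(t)` real by `EulerFactorLawOmega` (f), `Complex.Gamma_ofReal`),
and `sysOmega f n` is the crux's exponent by `rfl`. -/
theorem stub_spliceOmega :
    ∀ (k : ℕ) (f : Fin k → ℤ[X]), IsBatemanHornSystem f →
      EulerFactorLawOmega k f → SmallPrimeSumOmega k f → IntegerEwens → TiltedTailsOmega k f →
        CubeFreeTailOmega k f → KPD k f →
          ∀ y : ℝ, 5 / 4 < y → y < 7 / 4 → SegmentLawAt k f (eulerFactorOmega f) y := by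
  sorry

/-! ### Glue, part 1 (PROVED): the un-capped expansion `t^{Ω(m)} = Σ_{d ∣ m} g_t(d)` -/

section Identity

variable {R : Type*} [CommRing R]

/-- `g_t` as an arithmetic function (`0 ↦ 0`). -/
def gArith (t : R) : ArithmeticFunction R :=
  ⟨fun d => if d = 0 then 0 else gWeight t d, by simp⟩

theorem gArith_apply (t : R) {d : ℕ} (hd : d ≠ 0) : gArith t d = gWeight t d := by
  simp [gArith, hd]

theorem isMultiplicative_gArith (t : R) : (gArith t).IsMultiplicative := by
  refine ⟨by simp [gArith, gWeight], ?_⟩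
  intro m n hmn
  rcases eq_or_ne m 0 with rfl | hm
  · simp [gArith]
  rcases eq_or_ne n 0 with rfl | hn
  · simp [gArith]
  rw [gArith_apply t (mul_ne_zero hm hn), gArith_apply t hm, gArith_apply t hn]
  exact gWeight_mul t hm hn hmn

/-- `m ↦ t^{Ω(m)}` as an arithmetic function (`0 ↦ 0`). -/
def omegaPowArith (t : R) : ArithmeticFunction R :=
  ⟨fun m => if m = 0 then 0 else t ^ cardFactors m, by simp⟩

theorem omegaPowArith_apply (t : R) {m : ℕ} (hm : m ≠ 0) : omegaPowArith t m = t ^ cardFactors m := by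
  simp [omegaPowArith, hm]

theorem isMultiplicative_omegaPowArith (t : R) : (omegaPowArith t).IsMultiplicative := by
  refine ⟨by simp [omegaPowArith], ?_⟩
  intro m n hmn
  rcases eq_or_ne m 0 with rfl | hm
  · simp [omegaPowArith]
  rcases eq_or_ne n 0 with rfl | hn
  · simp [omegaPowArith]
  rw [omegaPowArith_apply t (mul_ne_zero hm hn), omegaPowArith_apply t hm, omegaPowArith_apply t hn,
    ArithmeticFunction.cardFactors_mul hm hn, pow_add]

/-- Möbius inversion on prime powers: `g_t * ζ = t^{Ω}` as arithmetic functions. -/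
theorem gArith_mul_zeta (t : R) :
    gArith t * (ArithmeticFunction.zeta : ArithmeticFunction R) = omegaPowArith t := by
  rw [ArithmeticFunction.IsMultiplicative.eq_iff_eq_on_prime_powers _
    ((isMultiplicative_gArith t).mul ArithmeticFunction.isMultiplicative_zeta.natCast) _
    (isMultiplicative_omegaPowArith t)]
  intro p i hp
  rw [ArithmeticFunction.coe_mul_zeta_apply, Nat.sum_divisors_prime_pow hp,
    omegaPowArith_apply t (pow_ne_zero _ hp.ne_zero), ArithmeticFunction.cardFactors_apply_prime_pow hp]
  rw [Finset.sum_congr rfl fun j _ => by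
    rw [gArith_apply t (pow_ne_zero _ hp.ne_zero), gWeight_prime_pow t hp]]
  exact sum_gCoeff_range t i

/-- **THE UN-CAPPED EXPANSION** `t^{Ω(m)} = Σ_{d ∣ m} g_t(d)` for `m ≥ 1` (all prime powers, no cap). -/
theorem pow_cardFactors_eq_sum_divisors (t : R) {m : ℕ} (hm : m ≠ 0) :
    t ^ cardFactors m = ∑ d ∈ m.divisors, gWeight t d := by
  have h : (gArith t * (ArithmeticFunction.zeta : ArithmeticFunction R)) m = omegaPowArith t m := by
    rw [gArith_mul_zeta]
  rw [ArithmeticFunction.coe_mul_zeta_apply, omegaPowArith_apply t hm] at h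
  rw [← h]
  exact Finset.sum_congr rfl fun d hd => gArith_apply t (Nat.pos_of_mem_divisors hd).ne'

/-- The system expansion over divisor tuples of POSITIVE values:
`t^{Ω_f(n)} = Σ_{d : dᵢ ∣ fᵢ(n)} ∏ᵢ g_t(dᵢ)` whenever every `fᵢ(n) > 0` (the only case the splice expands —
`false_without_leadingCoeff_pos`). -/
theorem pow_sysOmega_eq_sum_tuples {k : ℕ} (f : Fin k → ℤ[X]) (t : R) {n : ℕ} (hn : ∀ i, val f i n ≠ 0) :
    t ^ sysOmega f n = ∑ d ∈ Fintype.piFinset fun i => (val f i n).divisors, ∏ i, gWeight t (d i) := by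
  rw [sysOmega, ← Finset.prod_pow_eq_pow_sum,
    Finset.prod_congr rfl fun i _ => pow_cardFactors_eq_sum_divisors t (hn i), Finset.prod_univ_sum]

end Identity

/-! ### Glue, part 2 (PROVED): sanity of the typing against the Disproof record -/

/-- `sysOmega` IS the crux's exponent (so `SegmentLawAt` is the crux's clause for the given `Λ`). -/
theorem sysOmega_eq {k : ℕ} (f : Fin k → ℤ[X]) (n : ℕ) :
    sysOmega f n = ∑ i, ArithmeticFunction.cardFactors (((f i).eval (n : ℤ)).toNat) := rfl

/-- `k = 0` calibration (`Negative.LoadBearing.lsdRealSegment_fin_zero`): for the empty system every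
`densOmega f p ν` is `[ν = 0]`, every local factor and every partial Euler product is `1`, hence
`λ_∅^Ω ≡ 1 = C(∅)` — the stubs degenerate consistently. -/
theorem eulerFactorOmega_fin_zero (f : Fin 0 → ℤ[X]) (z : ℂ) : eulerFactorOmega f z = 1 := by
  have hdvd : ∀ {p : ℕ}, p.Prime → ∀ (m n : ℕ),
      ((p : ℤ) ^ m ∣ ∏ i : Fin 0, (f i).eval (n : ℤ)) ↔ m = 0 := by
    intro p hp m n
    rw [Finset.univ_eq_empty, Finset.prod_empty]
    constructor
    · intro h
      have h' : p ^ m ∣ 1 := by exact_mod_cast h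
      rcases Nat.pow_eq_one.mp (Nat.dvd_one.mp h') with h1 | h1
      · exact absurd h1 hp.one_lt.ne'
      · exact h1
    · rintro rfl
      simp
  have hdens : ∀ {p : ℕ}, p.Prime → ∀ ν : ℕ, densOmega f p ν = if ν = 0 then 1 else 0 := by
    intro p hp ν
    unfold densOmega
    have hp0 : (p : ℝ) ≠ 0 := by exact_mod_cast hp.ne_zero
    by_cases hν : ν = 0
    · subst hν
      rw [if_pos rfl, Finset.filter_true_of_mem, Finset.card_range]
      · push_cast
        exact div_self (pow_ne_zero _ hp0)
      · intro n _
        exact ⟨(hdvd hp 0 n).mpr rfl, fun h => Nat.succ_ne_zero 0 ((hdvd hp (0 + 1) n).mp h)⟩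
    · rw [if_neg hν, Finset.filter_false_of_mem, Finset.card_empty]
      · simp
      · intro n _ h
        exact hν ((hdvd hp ν n).mp h.1)
  have hE : ∀ {p : ℕ}, p.Prime → localFactorOmega f p z = 1 := by
    intro p hp
    unfold localFactorOmega
    simp_rw [hdens hp]
    rw [tsum_eq_single 0 (fun ν hν => by simp [hν])]
    simp
  have ht : Tendsto (fun N : ℕ => eulerPartialOmega f N z) atTop (𝓝 1) := by
    refine tendsto_const_nhds.congr fun N => ?_
    unfold eulerPartialOmega
    refine (Finset.prod_eq_one fun p hp => ?_).symm
    rw [hE (Nat.prime_of_mem_primesLE hp)]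
    simp
  exact ht.limUnder_eq

/-- The `P`-smooth part of a non-zero integer divides it. [folklore] -/
theorem prod_primesLE_pow_padicValNat_dvd (P : ℕ) {n : ℕ} (hn : n ≠ 0) :
    (∏ p ∈ Nat.primesLE P, p ^ padicValNat p n) ∣ n := by
  have h := Nat.prod_pow_prime_padicValNat n hn (max n P + 1) (by omega)
  conv_rhs => rw [← h]
  refine Finset.prod_dvd_prod_of_subset _ _ _ fun p hp => ?_
  rw [Nat.mem_primesLE] at hp
  exact Finset.mem_filter.mpr ⟨Finset.mem_range.mpr (by omega), hp.2⟩

/-- **Calibration of the new Diophantine stub at the linear rung** (`Negative.LinearRung`, `f = X`):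
`SpikeControl 1 ![X]` holds with the trivial bound `[n]_S ≤ n ≤ n^{1+ε}` — and shows that the exponent `1`
in `SpikeControl` cannot be lowered (at `n = 2^a` the `2`-part IS `n`), so the line's room is exactly
`log₂ t < 1`, i.e. `t < 2`. [folklore] -/
theorem spikeControl_X : SpikeControl 1 ![X] := by
  intro P ε hε
  filter_upwards [eventually_ge_atTop 1] with n hn
  have hval : (∏ i, val ![X] i n) = n := by
    simp [val]
  rw [hval]
  have hdvd := prod_primesLE_pow_padicValNat_dvd P (Nat.one_le_iff_ne_zero.mp hn)
  have hle : (∏ p ∈ Nat.primesLE P, p ^ padicValNat p n : ℕ) ≤ n := Nat.le_of_dvd (by omega) hdvd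
  have hn1 : (1 : ℝ) ≤ n := by exact_mod_cast hn
  calc (∏ p ∈ Nat.primesLE P, ((p : ℝ) ^ padicValNat p n))
      = ((∏ p ∈ Nat.primesLE P, p ^ padicValNat p n : ℕ) : ℝ) := by push_cast; rfl
    _ ≤ (n : ℝ) := by exact_mod_cast hle
    _ ≤ (n : ℝ) ^ (1 + ε) := Real.self_le_rpow_of_one_le hn1 (by linarith)

/-- What `SpikeControl` buys against `Negative.NoSpikes`: the crux FORCES the single normalised term to `0`
(`tendsto_term_zero_of_lsdRealSegment`, imported), and the line meets this necessity through `stub_spikeControl`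
at `stub_peeledTails` (o).  Recorded here as the implication the skeleton itself yields. -/
theorem noSpikes_of_skeleton (h : LSDRealSegment) {k : ℕ} {f : Fin k → ℤ[X]} (hf : IsBatemanHornSystem f)
    {y : ℝ} (hy : 5 / 4 < y) (hy' : y < 7 / 4) :
    Tendsto (fun x : ℕ => (x : ℂ)⁻¹ * Complex.exp ((k : ℂ) * (1 - (y : ℂ)) * (Real.log (Real.log x) : ℂ)) *
      (y : ℂ) ^ sysOmega f x) atTop (𝓝 0) :=
  Summit.Parity.BatemanHorn.Theorems.LSDRealSegment.Negative.tendsto_term_zero_of_lsdRealSegment h hf hy hy'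

/-! ### The composition: the stubs imply the crux BY NAME -/

/-- **The crux's statement from the seven stub STATEMENTS** (hypothesis form; real proof, no `sorry`).  The
conclusion is the crux's body verbatim (so that the by-name audit sees exactly one theorem concluding
`LSDRealSegment`, the next one).  Proof: `Λ := eulerFactorOmega f`; holomorphy on `ball 0 2` and `Λ 0 = C(f)`
are clauses of `EulerFactorLawOmega`; the segment law is the splice. -/
theorem lsdRealSegment_of_parts
    (hE : ∀ (k : ℕ) (f : Fin k → ℤ[X]), IsBatemanHornSystem f → EulerFactorLawOmega k f ∧ SmallPrimeSumOmega k f)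
    (hI : IntegerEwens)
    (hR : ∀ (k : ℕ) (f : Fin k → ℤ[X]), IsBatemanHornSystem f → SpikeControl k f)
    (hT : ∀ (k : ℕ) (f : Fin k → ℤ[X]), IsBatemanHornSystem f → SpikeControl k f → TiltedTailsOmega k f)
    (hC : ∀ (k : ℕ) (f : Fin k → ℤ[X]), IsBatemanHornSystem f → TiltedTailsOmega k f → CubeFreeTailOmega k f)
    (hK : ∀ (k : ℕ) (f : Fin k → ℤ[X]), IsBatemanHornSystem f → KPD k f)
    (hSp : ∀ (k : ℕ) (f : Fin k → ℤ[X]), IsBatemanHornSystem f →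
      EulerFactorLawOmega k f → SmallPrimeSumOmega k f → IntegerEwens → TiltedTailsOmega k f →
        CubeFreeTailOmega k f → KPD k f →
          ∀ y : ℝ, 5 / 4 < y → y < 7 / 4 → SegmentLawAt k f (eulerFactorOmega f) y) :
    ∀ (k : ℕ) (f : Fin k → Polynomial ℤ), Literature.NumberTheory.Sieve.IsBatemanHornSystem f →
      ∃ Λ : ℂ → ℂ, DifferentiableOn ℂ Λ (Metric.ball 0 2) ∧
        Λ 0 = (Literature.NumberTheory.Sieve.batemanHornConst f : ℂ) ∧
        ∀ y : ℝ, 5 / 4 < y → y < 7 / 4 → Filter.Tendsto (fun x : ℕ => (x : ℂ)⁻¹ *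
          Complex.exp ((k : ℂ) * (1 - (y : ℂ)) * (Real.log (Real.log x) : ℂ)) *
          ∑ n ∈ Finset.range (x + 1), (y : ℂ) ^ (∑ i, ArithmeticFunction.cardFactors (((f i).eval (n : ℤ)).toNat)))
          Filter.atTop (nhds (Λ y * Complex.exp (((y : ℂ) - 1) *
          (Real.log (∏ i, ((f i).natDegree : ℝ)) : ℂ)) * (Complex.Gamma y)⁻¹ ^ k)) := by
  intro k f hf
  obtain ⟨hEuler, hSmall⟩ := hE k f hf
  have hTails := hT k f hf (hR k f hf)
  exact ⟨eulerFactorOmega f, hEuler.2.2.1, hEuler.2.2.2.1, fun y hy hy' =>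
    hSp k f hf hEuler hSmall hI hTails (hC k f hf hTails) (hK k f hf) y hy hy'⟩

/-- **Uniqueness check against the landed Negative lemma** `Negative.Structure.omegaLaw_Λ_unique` (imported):
under the seven inputs, ANY `Λ` holomorphic on the ball satisfying the crux's segment law for `f` coincides with
`eulerFactorOmega f` on `|z| < 2` — the line produces exactly the function the identity theorem pins. -/
theorem eulerFactorOmega_unique_of_parts
    (hE : ∀ (k : ℕ) (f : Fin k → ℤ[X]), IsBatemanHornSystem f → EulerFactorLawOmega k f ∧ SmallPrimeSumOmega k f)
    (hI : IntegerEwens)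
    (hR : ∀ (k : ℕ) (f : Fin k → ℤ[X]), IsBatemanHornSystem f → SpikeControl k f)
    (hT : ∀ (k : ℕ) (f : Fin k → ℤ[X]), IsBatemanHornSystem f → SpikeControl k f → TiltedTailsOmega k f)
    (hC : ∀ (k : ℕ) (f : Fin k → ℤ[X]), IsBatemanHornSystem f → TiltedTailsOmega k f → CubeFreeTailOmega k f)
    (hK : ∀ (k : ℕ) (f : Fin k → ℤ[X]), IsBatemanHornSystem f → KPD k f)
    (hSp : ∀ (k : ℕ) (f : Fin k → ℤ[X]), IsBatemanHornSystem f →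
      EulerFactorLawOmega k f → SmallPrimeSumOmega k f → IntegerEwens → TiltedTailsOmega k f →
        CubeFreeTailOmega k f → KPD k f →
          ∀ y : ℝ, 5 / 4 < y → y < 7 / 4 → SegmentLawAt k f (eulerFactorOmega f) y)
    {k : ℕ} {f : Fin k → ℤ[X]} (hf : IsBatemanHornSystem f) {Λ : ℂ → ℂ}
    (hΛ : DifferentiableOn ℂ Λ (Metric.ball 0 2))
    (hlaw : ∀ y : ℝ, 5 / 4 < y → y < 7 / 4 → SegmentLawAt k f Λ y) :
    Set.EqOn Λ (eulerFactorOmega f) (Metric.ball 0 2) := by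
  obtain ⟨hEuler, hSmall⟩ := hE k f hf
  have hdiff : DifferentiableOn ℂ (eulerFactorOmega f) (Metric.ball 0 2) := hEuler.2.2.1
  have hTails := hT k f hf (hR k f hf)
  have hlaw' := fun y hy hy' => hSp k f hf hEuler hSmall hI hTails (hC k f hf hTails) (hK k f hf) y hy hy'
  refine Summit.Parity.BatemanHorn.Theorems.LSDRealSegment.Negative.omegaLaw_Λ_unique (k := k) (f := f) hΛ hdiff
    (fun y hy hy' => ?_) (fun y hy hy' => ?_)
  · simpa only [SegmentLawAt, mul_assoc] using hlaw y hy hy'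
  · simpa only [SegmentLawAt, mul_assoc] using hlaw' y hy hy'

/-- **The line concludes the crux BY NAME** (the `#h21_check_skeleton` theorem): the seven registered stubs, fed
to `lsdRealSegment_of_parts`, give `Summit.Parity.BatemanHorn.Theses.SelbergDelangeRigidity.LSDRealSegment`.
No `sorry` of its own; its axiom closure contains `sorryAx` exactly through the seven `stub_*`. -/
theorem LSDRealSegment_of : LSDRealSegment :=
  lsdRealSegment_of_parts stub_localEulerOmega stub_integerEwens stub_spikeControl stub_peeledTails
    stub_cubeFreeTail stub_kpd stub_spliceOmega

end

end Summit.Parity.BatemanHorn.Cruxes.LSDRealSegment.SharedKernelUncappedTransfer
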